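import Summits.CriticalPhenomena.Ising3D.TaylorQPolyIntervalList
import Summits.CriticalPhenomena.Ising3D.TaylorRegionQPoly
import Summits.CriticalPhenomena.Ising3D.Control2DTaylorHalf
import Mathlib.Tactic.Linarith
import Mathlib.Tactic.Positivity
import Mathlib.Tactic.Ring
import HarnessLib

/-!
# The identity q-sums as EXACT univariate polynomials in `Δ` (T6 piece (i): centred-form identity check for slaved-Ψ boxes)
(cell `pub-ising3x`, seat boot-1 gen 17; HOME/pub-ising3x-boot-1/b3spine-g17/IDENTITY-B3.md)

HONEST FRAMING: lottery ticket; floor = tightest certified 3D Ising CFT bounds; no exact-solution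
claim without a proof. Island framing: certified exclusion region at stated derivative order and
assumptions; not a determination of the 3D Ising critical exponents beyond that.

The identity obligation of a γ-box certificate is `Î₁(Δσ) + κ² Î₂(Δε) + κ (Î₄+Î₅)(s̄) > 0` with the
`E = 0, j = 0` q-sums `Îᵢ(s) = qSum (cᵢ ·) S s σ 0 0` (`identityTerm_taylorCrossing_half_pos_iff`).
At `E = j = 0` the inner antidiagonal collapses to `p = (0,0)` and `q¹(s,0;a) = (-1)^a C(s,a)`,
`q²(s,0;a) = C(s,a)`, so `Î(s) = Σ_{(a,b)∈S} c(a,b) 2^{a+b} ((-1)^{a+b} + σ) C(s,a) C(s,b)` — an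
explicit POLYNOMIAL in `s` with rational coefficients. This file gives it as a `List ℚ`
(`idQSumListQ`, built from the tree's `chooseCoeffListQ` / `mulQL` / `smulQL` / `addQL`) with the
evaluation identity `evalR_idQSumListQ`. The centred-form leaf check (Taylor shift of these lists to
the leaf centre with `PolyMP.shiftI`, interval Horner, κ as an interval) is the next piece. [folklore]
-/

namespace Summit.CriticalPhenomena.Ising3D

open Finset
open Literature.Analysis.ValidatedNumerics.PolyMP
open Literature.MathematicalPhysics.QuantumFieldTheory.ConformalBootstrap3D

/-- `q²(s,0;m) = C(s,m)` (only `j = 0` survives: `C(0,k) = 0` for `k ≥ 1`). [folklore] -/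
theorem qFactor₂_zero_right (s : ℝ) (m : ℕ) : qFactor₂ s 0 m = Ring.choose s m := by
  unfold qFactor₂
  rw [Finset.sum_eq_single_of_mem (m, 0) (by simp)]
  · rw [Ring.choose_zero_right]; ring
  · intro ij hij hne
    have hi : ij.1 + ij.2 = m := mem_antidiagonal.mp hij
    have h2 : ij.2 ≠ 0 := by
      intro h0
      apply hne
      ext <;> simp <;> omega
    rw [Ring.choose_zero_pos ℝ (Nat.pos_of_ne_zero h2), mul_zero, mul_zero]

/-- **The identity q-sum at `E = j = 0` in closed form**:
`qSum c S s σ 0 0 = Σ_{(a,b)∈S} c(a,b) 2^{a+b} ((-1)^{a+b} + σ) C(s,a) C(s,b)`. [folklore] -/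
theorem qSum_zero_zero_eq (c : ℕ × ℕ → ℝ) (S : Finset (ℕ × ℕ)) (s σ : ℝ) :
    qSum c S s σ 0 0 =
      ∑ ab ∈ S, c ab * 2 ^ (ab.1 + ab.2) *
        (((-1 : ℝ) ^ (ab.1 + ab.2) + σ) * (Ring.choose s ab.1 * Ring.choose s ab.2)) := by
  unfold qSum
  refine Finset.sum_congr rfl fun ab _ => ?_
  rw [Finset.Nat.antidiagonal_zero, Finset.sum_singleton]
  simp only [Nat.cast_zero, sub_zero, zero_div, zero_add, legendreLam_zero, one_mul,
    Control2D.qFactor₁_zero_right, qFactor₂_zero_right]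
  ring

/-- One term `c(a,b) 2^{a+b} ((-1)^{a+b} + σ) · C(s,a) C(s,b)` of the identity q-sum as a
coefficient list in `s`. [folklore] -/
def idQTermListQ (c : ℕ × ℕ → ℚ) (σ : ℚ) (ab : ℕ × ℕ) : List ℚ :=
  smulQL (c ab * 2 ^ (ab.1 + ab.2) * ((-1) ^ (ab.1 + ab.2) + σ))
    (mulQL (chooseCoeffListQ ab.1) (chooseCoeffListQ ab.2))

/-- **The identity q-sum `qSum c L s σ 0 0` as an exact coefficient list in `s`** (sum of
`idQTermListQ` over the index list). [folklore] -/
def idQSumListQ (c : ℕ × ℕ → ℚ) (σ : ℚ) : List (ℕ × ℕ) → List ℚ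
  | [] => []
  | ab :: l => addQL (idQTermListQ c σ ab) (idQSumListQ c σ l)

/-- Evaluation of one term. [folklore] -/
theorem evalR_idQTermListQ (c : ℕ × ℕ → ℚ) (σ : ℚ) (ab : ℕ × ℕ) (s : ℝ) :
    evalR ((idQTermListQ c σ ab).map ((↑) : ℚ → ℝ)) s =
      (c ab : ℝ) * 2 ^ (ab.1 + ab.2) * (((-1 : ℝ) ^ (ab.1 + ab.2) + σ) *
        (Ring.choose s ab.1 * Ring.choose s ab.2)) := by
  rw [idQTermListQ, map_cast_smulQL, map_cast_mulQL, map_cast_chooseCoeffListQ,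
    map_cast_chooseCoeffListQ, evalR_smulR, evalR_mulR, evalR_chooseCoeffList, evalR_chooseCoeffList]
  push_cast
  ring

/-- Evaluation of the list = the list-indexed sum of the terms. [folklore] -/
theorem evalR_idQSumListQ_eq_sum (c : ℕ × ℕ → ℚ) (σ : ℚ) (s : ℝ) :
    ∀ l : List (ℕ × ℕ), evalR ((idQSumListQ c σ l).map ((↑) : ℚ → ℝ)) s =
      (l.map fun ab => (c ab : ℝ) * 2 ^ (ab.1 + ab.2) *
        (((-1 : ℝ) ^ (ab.1 + ab.2) + σ) * (Ring.choose s ab.1 * Ring.choose s ab.2))).sum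
  | [] => by simp [idQSumListQ]
  | ab :: l => by
      rw [idQSumListQ, map_cast_addQL, evalR_addR, evalR_idQTermListQ, evalR_idQSumListQ_eq_sum c σ s l,
        List.map_cons, List.sum_cons]

/-- **`evalR (idQSumListQ c σ L) s = qSum c L.toFinset s σ 0 0`** for a duplicate-free index list:
the identity q-sums of a rational certificate are exact univariate polynomials in `Δ`. [folklore] -/
theorem evalR_idQSumListQ (c : ℕ × ℕ → ℚ) (σ : ℚ) {L : List (ℕ × ℕ)} (hL : L.Nodup) (s : ℝ) :
    evalR ((idQSumListQ c σ L).map ((↑) : ℚ → ℝ)) s =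
      qSum (fun ab => (c ab : ℝ)) L.toFinset s σ 0 0 := by
  rw [evalR_idQSumListQ_eq_sum, qSum_zero_zero_eq, ← List.sum_toFinset _ hL]

/-! ### Kernel sanity check: the toy weights of `TaylorTableIdentity` (`c₀(1,0) = -1` ⇒ `Î₁(s) = 4s`) -/

/-- Toy weights `c(1,0) = -1`, else `0`. [folklore] -/
def toyW : ℕ × ℕ → ℚ := fun ab => if ab = (1, 0) then -1 else 0

/-- `idQSumListQ toyW (-1) [(1,0)] = [0, 4]`, i.e. `Î(s) = 4 s` — agrees with the smoke test of
`TaylorTableIdentity` ("the identity polynomial is `4Δσ`"). [folklore] -/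
example : idQSumListQ toyW (-1) [(1, 0)] = [0, 4] := by decide +kernel

end Summit.CriticalPhenomena.Ising3D
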